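import Summits.QuantumFields.YangMills.Theses.PoincareLipschitz
import Summits.QuantumFields.YangMills.Theorems.PoincareLipschitzLinearStep
import Summits.QuantumFields.YangMills.Theorems.PoincareLipschitzLinearBudget
import Summits.QuantumFields.YangMills.Theorems.PoincareLipschitzHistoryTailOfLinearTail
import Summits.QuantumFields.YangMills.Theorems.PoincareLipschitzTwoSidedOfConcentrationCounting
import Summits.QuantumFields.YangMills.Theorems.UnitScaleTiltHistoryTailBoundedHeightLocal
import HarnessLib

/-!
# Crux `HistoryTailL` (stmt-QuantumFields-19936), line #12 — THE p-LINEAR GLUE (A′3, THE KNIT):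
# `HistoryTailL ⟸ K1-exp ∧ BlockLipschitzL ∧ MeanDeviationL` — a POINCARÉ-CLASS concentration crux suffices for line #12

Cell `ym3-torus` (YM ladder rung R3 = continuum SU(2) Yang–Mills on the 3-torus — NOT d = 4, NOT infinite volume, NOT a mass gap, NOT the Clay
problem), width seat `ym-ust-19936-w4` gen 12; `--supports stmt-QuantumFields-19936 --as helper`.  The located relaxation of the memo
`K1-MESOSCOPIC-LOCATE-w4g12.md` (19936 evidence #46) §2, BY KERNEL.

K1-exp («exponential ∕ Poincaré-class concentration at the Hodge–Poincaré scale») is the text of the deciding crux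
`PoincareLipschitz.MesoscopicConcentrationL` (stmt-QuantumFields-23532) with its Gaussian profile `Cc·exp(−cc·β_K·r²∕(n²Λ²))` replaced by the
EXPONENTIAL profile `Cc·exp(−cc·√β_K·r∕(n·Λ))` — what a spectral gap `≥ cc²·β_K∕n²` of the cut-off Gibbs law on box-local gauge-invariant
observables yields (Gromov–Milman), and strictly WEAKER than the registered crux (`e^{−cc·s²} ≤ e^{cc∕4}·e^{−cc·s}`, see `expTail_of_gaussTail`).

* `expTail_of_gaussTail` — the registered (Gaussian) crux implies K1-exp (so the knit below is strictly more general than the registered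
  composition `HistoryTailL_of` ∘ ✓`twoSidedOfConcentration_proof` ∘ ✓`fibreConvexityTail_historyTailOfTwoSided_proof`).
* ★`local_tail_lin` — the height induction of ✓`PoincareLipschitz.local_tail` run with K1-exp: p-LINEAR local window tails
  `Gibbs_K({θ(K−j) ≤ dist1 Ū^j(∂a)} ∩ G(a,j)) ≤ Cc·exp(−(cc∕(68(CL+1)))·p(g_{K−j}))` for `b₀ ≥ 8·68(CL+1)∕cc` (one-height step
  ✓`local_step_lin` (A′1), budget ✓`localGood_budget_lin` (A′2), counting ✓`compl_localGood_subset`∕✓`card_near_le_real`, level 0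
  ✓`perPlaquette_boundedHeight_uniform`).
* ★★★`historyTailL_of_expConcentration (hC : K1-exp) (hLip : BlockLipschitzL) (hM : MeanDeviationL) : UnitScaleTilt.HistoryTailL` BY NAME
  (∘ ✓`historyTailL_of_linearTail` (B′): the global finer-small event lies in the local good set).

HONEST: route glue.  By kernel, line #12 closes the crux from a POINCARÉ-CLASS K1 (plus K2 = `BlockLipschitzL` and the shared `MeanDeviationL`);
K1-exp itself is OPEN (no spectral-gap ∕ log-Sobolev statement for a continuous gauge group at weak coupling is in print — [arXiv:2204.12737]
Assumption 1.1 is strong coupling); nothing of K1∕K2, the cruxes, rung R3 or the mass gap is proved.  THEOREMS ONLY, definition-free.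
[cite: Balaban1985UV3, (7) p.257 and (71) p.273]
-/

set_option autoImplicit false

noncomputable section

namespace Summit.QuantumFields.YangMills.Theorems.PoincareLipschitzLinear

open MeasureTheory
open scoped BigOperators
open Literature.MathematicalPhysics.QuantumFieldTheory.Balaban1983to89
open Literature.MathematicalPhysics.QuantumFieldTheory.Balaban1983to89.T3ContinuumYM3Torus
open Literature.MathematicalPhysics.QuantumFieldTheory.Balaban1983to89.T3UnitScaleTilt
open Literature.MathematicalPhysics.QuantumFieldTheory.Balaban1983to89.T3UnitLawDensityEML (ℰp measurableE_ℰp)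
open Summit.QuantumFields.YangMills.Theorems.HistoryTailBoundedHeightLocal (perPlaquette_boundedHeight_uniform)
open Summit.QuantumFields.YangMills.Theorems.PoincareLipschitz.TwoSidedOfConcentration
open Summit.QuantumFields.YangMills.Theorems.PoincareLipschitzHistoryTailOfLinearTail (historyTailL_of_linearTail)

/-! ## §1 The Gaussian crux implies the exponential one -/

/-- `e^{−c·s²} ≤ e^{c∕4}·e^{−c·s}` for `c ≥ 0` (since `s² ≥ s − ¼`): a Gaussian tail profile dominates the exponential one with the same rate.
[folklore] -/
theorem exp_neg_mul_sq_le {c : ℝ} (hc : 0 ≤ c) (s : ℝ) :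
    Real.exp (-(c * s ^ 2)) ≤ Real.exp (c / 4) * Real.exp (-(c * s)) := by
  rw [← Real.exp_add]
  refine Real.exp_le_exp.mpr ?_
  nlinarith [sq_nonneg (s - 1 / 2), hc]

/-- ★ **THE REGISTERED (GAUSSIAN) CRUX IMPLIES K1-exp**: the text of `PoincareLipschitz.MesoscopicConcentrationL` implies the same text with the
exponential profile `Cc·e^{cc∕4}·exp(−cc·√β_K·r∕(n·Λ))` (`β_K r²∕(n²Λ²) = (√β_K r∕(nΛ))²`). [folklore] -/
theorem expTail_of_gaussTail
    (hC : ∀ (L : ℕ), ∃ (Cc cc : ℝ), 0 ≤ Cc ∧ 0 < cc ∧ ∃ γ₁ : ℝ, 0 < γ₁ ∧ γ₁ ≤ 1 ∧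
      ∀ (F : T3Family) (γ : ℝ), F.L = L → 0 < γ → γ ≤ γ₁ → ∀ (K n : ℕ), 1 ≤ n →
        (n : ℝ) ≤ (F.scheme ℰp γ).β K → 2 * n ≤ (F.P K).sitesPerDir 0 →
        ∀ (x₀ : Site (F.P K) 0) (f : GaugeField (F.P K) 0 (Matrix.specialUnitaryGroup (Fin 2) ℂ) → ℝ) (Λ : ℝ), 0 < Λ →
          Measurable f → GaugeField.GaugeInvariant f →
          (∀ U U' : GaugeField (F.P K) 0 (Matrix.specialUnitaryGroup (Fin 2) ℂ),
            (∀ b : PBond (F.P K) 0, (∀ k, (b.src k - x₀ k).val < n) → (∀ k, (b.tgt k - x₀ k).val < n) → U b = U' b) →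
              f U = f U') →
          (∀ U U' : GaugeField (F.P K) 0 (Matrix.specialUnitaryGroup (Fin 2) ℂ),
            |f U - f U'| ≤ Λ * Real.sqrt (∑ b : PBond (F.P K) 0, GaugeGroup.dist1 (U b * (U' b)⁻¹) ^ 2)) →
          ∀ r : ℝ, 0 ≤ r →
            (gibbsK F ℰp γ K).real {U | r ≤ f U - ∫ V, f V ∂(gibbsK F ℰp γ K)} ≤
              Cc * Real.exp (-(cc * (F.scheme ℰp γ).β K * r ^ 2 / ((n : ℝ) ^ 2 * Λ ^ 2)))) :
    ∀ (L : ℕ), ∃ (Cc cc : ℝ), 0 ≤ Cc ∧ 0 < cc ∧ ∃ γ₁ : ℝ, 0 < γ₁ ∧ γ₁ ≤ 1 ∧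
      ∀ (F : T3Family) (γ : ℝ), F.L = L → 0 < γ → γ ≤ γ₁ → ∀ (K n : ℕ), 1 ≤ n →
        (n : ℝ) ≤ (F.scheme ℰp γ).β K → 2 * n ≤ (F.P K).sitesPerDir 0 →
        ∀ (x₀ : Site (F.P K) 0) (f : GaugeField (F.P K) 0 (Matrix.specialUnitaryGroup (Fin 2) ℂ) → ℝ) (Λ : ℝ), 0 < Λ →
          Measurable f → GaugeField.GaugeInvariant f →
          (∀ U U' : GaugeField (F.P K) 0 (Matrix.specialUnitaryGroup (Fin 2) ℂ),
            (∀ b : PBond (F.P K) 0, (∀ k, (b.src k - x₀ k).val < n) → (∀ k, (b.tgt k - x₀ k).val < n) → U b = U' b) →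
              f U = f U') →
          (∀ U U' : GaugeField (F.P K) 0 (Matrix.specialUnitaryGroup (Fin 2) ℂ),
            |f U - f U'| ≤ Λ * Real.sqrt (∑ b : PBond (F.P K) 0, GaugeGroup.dist1 (U b * (U' b)⁻¹) ^ 2)) →
          ∀ r : ℝ, 0 ≤ r →
            (gibbsK F ℰp γ K).real {U | r ≤ f U - ∫ V, f V ∂(gibbsK F ℰp γ K)} ≤
              Cc * Real.exp (-(cc * Real.sqrt ((F.scheme ℰp γ).β K) * r / ((n : ℝ) * Λ))) := by
  intro L
  obtain ⟨Cc, cc, hCc, hcc, γ₁, hγ₁, hγ₁1, H⟩ := hC L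
  refine ⟨Cc * Real.exp (cc / 4), cc, by positivity, hcc, γ₁, hγ₁, hγ₁1, ?_⟩
  intro F γ hFL hγ hγle K n hn hnβ h2n x₀ f Λ hΛ hfm hinv hloc hLip r hr
  have hβ0 : 0 ≤ (F.scheme ℰp γ).β K := F.scheme_β_nonneg ℰp hγ.le K
  have hn0 : (0 : ℝ) < (n : ℝ) := by exact_mod_cast (Nat.lt_of_lt_of_le Nat.zero_lt_one hn)
  refine (H F γ hFL hγ hγle K n hn hnβ h2n x₀ f Λ hΛ hfm hinv hloc hLip r hr).trans ?_
  have hs : cc * (F.scheme ℰp γ).β K * r ^ 2 / ((n : ℝ) ^ 2 * Λ ^ 2) =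
      cc * (Real.sqrt ((F.scheme ℰp γ).β K) * r / ((n : ℝ) * Λ)) ^ 2 := by
    rw [div_pow, mul_pow, mul_pow, Real.sq_sqrt hβ0]; ring
  have hs' : cc * Real.sqrt ((F.scheme ℰp γ).β K) * r / ((n : ℝ) * Λ) =
      cc * (Real.sqrt ((F.scheme ℰp γ).β K) * r / ((n : ℝ) * Λ)) := by ring
  rw [hs, hs', mul_assoc]
  exact mul_le_mul_of_nonneg_left (exp_neg_mul_sq_le hcc.le _) hCc

/-! ## §2 The height induction with K1-exp: p-linear local window tails -/

/-- ★ **THE LOCAL WINDOW TAIL BY INDUCTION ON THE HEIGHT, FROM K1-exp** — ✓`PoincareLipschitz.local_tail` run with the exponential concentration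
hypothesis: for every `L` there are `bmin`, `C = Cc ≥ 0`, `c = cc∕(68(CL+1)) > 0` such that for all `b₀ ≥ bmin = 8∕c`, `b₀ > 0`, `p₀ > 2` some
`γ₁ ∈ (0,1]` gives, for every family `F` with `F.L = L`, every `0 < γ ≤ γ₁`, all `1 ≤ j ≤ K − 2` and every level-`j` plaquette `a`,
`Gibbs_K({θ(K−j) ≤ dist1(Ū^j(∂a))} ∩ G(a,j)) ≤ C·exp(−c·p(g_{K−j}))` (`G(a,j)` the local good set).  Strong induction on `j` exactly as in the
landed proof, with ✓`local_step_lin` and ✓`localGood_budget_lin`. [adapted from ✓`PoincareLipschitzTwoSidedOfConcentration.local_tail`;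
cite: Balaban1985UV3, (7) p.257 and (71) p.273] -/
theorem local_tail_lin
    (hC : ∀ (L : ℕ), ∃ (Cc cc : ℝ), 0 ≤ Cc ∧ 0 < cc ∧ ∃ γ₁ : ℝ, 0 < γ₁ ∧ γ₁ ≤ 1 ∧
      ∀ (F : T3Family) (γ : ℝ), F.L = L → 0 < γ → γ ≤ γ₁ → ∀ (K n : ℕ), 1 ≤ n →
        (n : ℝ) ≤ (F.scheme ℰp γ).β K → 2 * n ≤ (F.P K).sitesPerDir 0 →
        ∀ (x₀ : Site (F.P K) 0) (f : GaugeField (F.P K) 0 (Matrix.specialUnitaryGroup (Fin 2) ℂ) → ℝ) (Λ : ℝ), 0 < Λ →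
          Measurable f → GaugeField.GaugeInvariant f →
          (∀ U U' : GaugeField (F.P K) 0 (Matrix.specialUnitaryGroup (Fin 2) ℂ),
            (∀ b : PBond (F.P K) 0, (∀ k, (b.src k - x₀ k).val < n) → (∀ k, (b.tgt k - x₀ k).val < n) → U b = U' b) →
              f U = f U') →
          (∀ U U' : GaugeField (F.P K) 0 (Matrix.specialUnitaryGroup (Fin 2) ℂ),
            |f U - f U'| ≤ Λ * Real.sqrt (∑ b : PBond (F.P K) 0, GaugeGroup.dist1 (U b * (U' b)⁻¹) ^ 2)) →
          ∀ r : ℝ, 0 ≤ r →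
            (gibbsK F ℰp γ K).real {U | r ≤ f U - ∫ V, f V ∂(gibbsK F ℰp γ K)} ≤
              Cc * Real.exp (-(cc * Real.sqrt ((F.scheme ℰp γ).β K) * r / ((n : ℝ) * Λ))))
    (hLip : Summit.QuantumFields.YangMills.Theses.PoincareLipschitz.BlockLipschitzL)
    (hM : Summit.QuantumFields.YangMills.Theses.PoincareLipschitz.MeanDeviationL) (L : ℕ) :
    ∃ (bmin C c : ℝ), 0 ≤ C ∧ 0 < c ∧ ∀ (b₀ p₀ : ℝ), bmin ≤ b₀ → 0 < b₀ → 2 < p₀ →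
      ∃ γ₁ : ℝ, 0 < γ₁ ∧ γ₁ ≤ 1 ∧ ∀ (F : T3Family) (γ : ℝ), F.L = L → 0 < γ → γ ≤ γ₁ →
      ∀ (K j : ℕ), 1 ≤ j → j + 2 ≤ K → ∀ a : Plaq (F.P K) j,
        (gibbsK F ℰp γ K).real ({U : GaugeField (F.P K) 0 (Matrix.specialUnitaryGroup (Fin 2) ℂ) | θBal F.L γ b₀ p₀ (K - j) ≤ GaugeGroup.dist1 (GaugeField.plaqHol (Averaging.iter (fun i' => BlockAveraging.blockAvg (P := F.P K) (j := i') ℰp) j U) a)} ∩ {U : GaugeField (F.P K) 0 (Matrix.specialUnitaryGroup (Fin 2) ℂ) | (∀ (i : ℕ) (q : Plaq (F.P K) i), i < j → Site.tdist (fun k => ((((q.src k).val * F.L ^ i : ℕ)) : ZMod ((F.P K).sitesPerDir 0))) (fun k => ((((a.src k).val * F.L ^ j : ℕ)) : ZMod ((F.P K).sitesPerDir 0))) + 64 * F.L ^ i ≤ 64 * F.L ^ j → GaugeGroup.dist1 (GaugeField.plaqHol (Averaging.iter (fun i' => BlockAveraging.blockAvg (P := F.P K) (j := i') ℰp) i U)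 q) < θBal F.L γ b₀ p₀ (K - i))}) ≤
          C * Real.exp (-(c * B10.pFun b₀ p₀ (Real.sqrt (γ * ((F.L : ℝ)⁻¹) ^ (K - j))))) := by
  -- the constants of the three hypotheses and of the level-0 input
  obtain ⟨Cc, cc, hCc, hcc, γC, hγC, hγC1, HC⟩ := hC L
  obtain ⟨CL, hCL, HLip⟩ := hLip L
  obtain ⟨C₀, c₀, hC₀, hc₀, H0⟩ := perPlaquette_boundedHeight_uniform L 0
  -- degenerate block size: no family has `F.L = L < 2`
  by_cases hL : 2 ≤ L
  swap
  · refine ⟨0, 0, 1, le_rfl, one_pos, fun b₀ p₀ _ _ _ => ⟨1, one_pos, le_rfl, fun F γ hFL => ?_⟩⟩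
    exact absurd (hFL ▸ F.hL.2) (by omega)
  -- the p-linear rate and the profile threshold `c₁ b₀ ≥ 8`
  set c₁ : ℝ := cc / (68 * (CL + 1)) with hc₁
  have hc₁pos : 0 < c₁ := by positivity
  refine ⟨8 / c₁, Cc, c₁, hCc, hc₁pos, fun b₀ p₀ hbmin hb₀ hp₀ => ?_⟩
  have hcb : 8 ≤ c₁ * b₀ := by
    have h := mul_le_mul_of_nonneg_left hbmin hc₁pos.le
    rwa [mul_div_cancel₀ _ hc₁pos.ne'] at h
  obtain ⟨γLip, hγLip, hγLip1, HLip'⟩ := HLip b₀ p₀ hb₀ hp₀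
  obtain ⟨γM, hγM, hγM1, HM⟩ := hM L b₀ p₀ hb₀ hp₀
  obtain ⟨γA, hγA, hγA1, HA⟩ := localGood_budget_lin hL hb₀ (by linarith : (1 : ℝ) ≤ p₀)
    (by norm_num : (0 : ℝ) ≤ 9 * 129 ^ 3) hC₀ hc₀ hCc hc₁pos hcb
  refine ⟨min γC (min γLip (min γM (min γA (1 / 2)))), by positivity, (min_le_left _ _).trans hγC1,
    fun F γ hFL hγ hγle K => ?_⟩
  have hγC' : γ ≤ γC := hγle.trans (min_le_left _ _)
  have hγLip' : γ ≤ γLip := hγle.trans ((min_le_right _ _).trans (min_le_left _ _))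
  have hγM' : γ ≤ γM := hγle.trans ((min_le_right _ _).trans ((min_le_right _ _).trans (min_le_left _ _)))
  have hγA' : γ ≤ γA :=
    hγle.trans ((min_le_right _ _).trans ((min_le_right _ _).trans ((min_le_right _ _).trans (min_le_left _ _))))
  have hγ2 : γ ≤ 1 / 2 :=
    hγle.trans ((min_le_right _ _).trans ((min_le_right _ _).trans ((min_le_right _ _).trans (min_le_right _ _))))
  have hγ1 : γ ≤ 1 := by linarith
  subst hFL
  haveI := isProbabilityMeasure_gibbsK F ℰp hγ.le K
  have hβ : (F.scheme ℰp γ).β K = (γ * ((F.L : ℝ)⁻¹) ^ K)⁻¹ := rfl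
  -- strong induction on the level `j`
  intro j
  induction j using Nat.strong_induction_on with
  | _ j ih =>
  intro hj hjK a
  -- the complement of the local good set is rare
  have hGc : (gibbsK F ℰp γ K).real {U : GaugeField (F.P K) 0 (Matrix.specialUnitaryGroup (Fin 2) ℂ) | (∀ (i : ℕ) (q : Plaq (F.P K) i), i < j → Site.tdist (fun k => ((((q.src k).val * F.L ^ i : ℕ)) : ZMod ((F.P K).sitesPerDir 0))) (fun k => ((((a.src k).val * F.L ^ j : ℕ)) : ZMod ((F.P K).sitesPerDir 0))) + 64 * F.L ^ i ≤ 64 * F.L ^ j → GaugeGroup.dist1 (GaugeField.plaqHol (Averaging.iter (fun i' => BlockAveraging.blockAvg (P := F.P K) (j := i') ℰp) i U) q) < θBal F.L γ b₀ p₀ (K - i))}ᶜ ≤ 1 / 4 := by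
    have hcov := compl_localGood_subset F (X := GaugeField (F.P K) 0 (Matrix.specialUnitaryGroup (Fin 2) ℂ)) K j a
      (fun i q U => GaugeGroup.dist1 (GaugeField.plaqHol (Averaging.iter (fun i' => BlockAveraging.blockAvg (P := F.P K) (j := i') ℰp) i U) q)) (fun i => θBal F.L γ b₀ p₀ (K - i))
    beta_reduce at hcov
    -- level 0: the tree's volume-uniform finest-level tail
    have h0 : ∀ q : Plaq (F.P K) 0, (gibbsK F ℰp γ K).real ({U : GaugeField (F.P K) 0 (Matrix.specialUnitaryGroup (Fin 2) ℂ) | θBal F.L γ b₀ p₀ (K - 0) ≤ GaugeGroup.dist1 (GaugeField.plaqHol (Averaging.iter (fun i' => BlockAveraging.blockAvg (P := F.P K) (j := i') ℰp) 0 U) q)} ∩ {U : GaugeField (F.P K) 0 (Matrix.specialUnitaryGroup (Fin 2) ℂ) | (∀ (i' : ℕ) (q' : Plaq (F.P K) i'), i' < 0 → Site.tdist (fun k => ((((q'.src k).val * F.L ^ i' : ℕ)) : ZMod ((F.P K).sitesPerDir 0))) (fun k => ((((q.src k).val * F.L ^ 0 : ℕ)) : ZMod ((F.P K).sitesPerDir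 0))) + 64 * F.L ^ i' ≤ 64 * F.L ^ 0 → GaugeGroup.dist1 (GaugeField.plaqHol (Averaging.iter (fun i' => BlockAveraging.blockAvg (P := F.P K) (j := i') ℰp) i' U) q') < θBal F.L γ b₀ p₀ (K - i'))}) ≤
        C₀ * ((γ * ((F.L : ℝ)⁻¹) ^ K)⁻¹) ^ 5 * Real.exp (-(c₀ * B10.pFun b₀ p₀ (Real.sqrt (γ * ((F.L : ℝ)⁻¹) ^ (K))) ^ 2)) := by
      intro q
      have h := H0 F rfl γ hγ hγ1 b₀ hb₀.le p₀ K 0 (Nat.zero_le K) le_rfl q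
      simp only [Nat.sub_zero] at h
      rw [hβ] at h
      exact (measureReal_mono Set.inter_subset_left (measure_ne_top _ _)).trans h
    -- levels `1 ≤ i < j`: the induction hypothesis
    have hi : ∀ i ∈ Finset.Ico 1 j, ∀ q : Plaq (F.P K) i, (gibbsK F ℰp γ K).real ({U : GaugeField (F.P K) 0 (Matrix.specialUnitaryGroup (Fin 2) ℂ) | θBal F.L γ b₀ p₀ (K - i) ≤ GaugeGroup.dist1 (GaugeField.plaqHol (Averaging.iter (fun i' => BlockAveraging.blockAvg (P := F.P K) (j := i') ℰp) i U) q)} ∩ {U : GaugeField (F.P K) 0 (Matrix.specialUnitaryGroup (Fin 2) ℂ) | (∀ (i' : ℕ) (q' : Plaq (F.P K) i'), i' < i → Site.tdist (fun k => ((((q'.src k).val * F.L ^ i' : ℕ)) : ZMod ((F.P K).sitesPerDir 0))) (fun k => ((((q.src k).val * F.L ^ i : ℕ)) : ZMod ((F.P K).sitesPerDir 0))) + 64 * F.L ^ i' ≤ 64 * F.L ^ i → GaugeGroup.dist1 (GaugeField.plaqHol (Averaging.iter (fun i' => BlockAveraging.blockAvg (P := F.P K) (j := i') ℰp) i' U)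 q') < θBal F.L γ b₀ p₀ (K - i'))}) ≤
        Cc * Real.exp (-(c₁ * B10.pFun b₀ p₀ (Real.sqrt (γ * ((F.L : ℝ)⁻¹) ^ (K - i))))) := by
      intro i hi q
      rw [Finset.mem_Ico] at hi
      exact ih i hi.2 hi.1 (by omega) q
    -- the counts
    have hN : ∀ i, i ≤ j → (((Finset.univ.filter fun q : Plaq (F.P K) i => Site.tdist (fun k => ((((q.src k).val * F.L ^ i : ℕ)) : ZMod ((F.P K).sitesPerDir 0))) (fun k => ((((a.src k).val * F.L ^ j : ℕ)) : ZMod ((F.P K).sitesPerDir 0))) + 64 * F.L ^ i ≤ 64 * F.L ^ j)).card : ℝ) ≤ 9 * 129 ^ 3 * ((F.L : ℝ) ^ (j - i)) ^ 3 :=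
      fun i hij => card_near_le_real F hij (by omega) a
    calc (gibbsK F ℰp γ K).real {U : GaugeField (F.P K) 0 (Matrix.specialUnitaryGroup (Fin 2) ℂ) | (∀ (i : ℕ) (q : Plaq (F.P K) i), i < j → Site.tdist (fun k => ((((q.src k).val * F.L ^ i : ℕ)) : ZMod ((F.P K).sitesPerDir 0))) (fun k => ((((a.src k).val * F.L ^ j : ℕ)) : ZMod ((F.P K).sitesPerDir 0))) + 64 * F.L ^ i ≤ 64 * F.L ^ j → GaugeGroup.dist1 (GaugeField.plaqHol (Averaging.iter (fun i' => BlockAveraging.blockAvg (P := F.P K) (j := i') ℰp) i U) q) < θBal F.L γ b₀ p₀ (K - i))}ᶜ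
        ≤ (gibbsK F ℰp γ K).real (⋃ i ∈ Finset.range j, ⋃ q ∈ (Finset.univ.filter fun q : Plaq (F.P K) i => Site.tdist (fun k => ((((q.src k).val * F.L ^ i : ℕ)) : ZMod ((F.P K).sitesPerDir 0))) (fun k => ((((a.src k).val * F.L ^ j : ℕ)) : ZMod ((F.P K).sitesPerDir 0))) + 64 * F.L ^ i ≤ 64 * F.L ^ j), ({U : GaugeField (F.P K) 0 (Matrix.specialUnitaryGroup (Fin 2) ℂ) | θBal F.L γ b₀ p₀ (K - i) ≤ GaugeGroup.dist1 (GaugeField.plaqHol (Averaging.iter (fun i' => BlockAveraging.blockAvg (P := F.P K) (j := i') ℰp) i U) q)} ∩ {U : GaugeField (F.P K) 0 (Matrix.specialUnitaryGroup (Fin 2) ℂ) | (∀ (i' : ℕ) (q' : Plaq (F.P K) i'), i' < i → Site.tdist (fun k => ((((q'.src k).val * F.L ^ i' : ℕ)) : ZMod ((F.P K).sitesPerDir 0))) (fun k => ((((q.src k).val * F.L ^ i : ℕ)) : ZMod ((F.P K).sitesPerDir 0))) + 64 * F.L ^ i' ≤ 64 * F.L ^ i → GaugeGroup.dist1 (GaugeField.plaqHol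 (Averaging.iter (fun i' => BlockAveraging.blockAvg (P := F.P K) (j := i') ℰp) i' U) q') < θBal F.L γ b₀ p₀ (K - i'))})) :=
          measureReal_mono hcov (measure_ne_top _ _)
      _ ≤ ∑ i ∈ Finset.range j, (gibbsK F ℰp γ K).real (⋃ q ∈ (Finset.univ.filter fun q : Plaq (F.P K) i => Site.tdist (fun k => ((((q.src k).val * F.L ^ i : ℕ)) : ZMod ((F.P K).sitesPerDir 0))) (fun k => ((((a.src k).val * F.L ^ j : ℕ)) : ZMod ((F.P K).sitesPerDir 0))) + 64 * F.L ^ i ≤ 64 * F.L ^ j), ({U : GaugeField (F.P K) 0 (Matrix.specialUnitaryGroup (Fin 2) ℂ) | θBal F.L γ b₀ p₀ (K - i) ≤ GaugeGroup.dist1 (GaugeField.plaqHol (Averaging.iter (fun i' => BlockAveraging.blockAvg (P := F.P K) (j := i') ℰp) i U) q)} ∩ {U : GaugeField (F.P K) 0 (Matrix.specialUnitaryGroup (Fin 2) ℂ) | (∀ (i' : ℕ) (q' : Plaq (F.P K) i'), i' < i → Site.tdist (fun k => ((((q'.src k).val * F.L ^ i' : ℕ)) : ZMod ((F.P K).sitesPerDir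 0))) (fun k => ((((q.src k).val * F.L ^ i : ℕ)) : ZMod ((F.P K).sitesPerDir 0))) + 64 * F.L ^ i' ≤ 64 * F.L ^ i → GaugeGroup.dist1 (GaugeField.plaqHol (Averaging.iter (fun i' => BlockAveraging.blockAvg (P := F.P K) (j := i') ℰp) i' U) q') < θBal F.L γ b₀ p₀ (K - i'))})) :=
          measureReal_biUnion_finset_le _ _
      _ ≤ ∑ i ∈ Finset.range j, ∑ q ∈ (Finset.univ.filter fun q : Plaq (F.P K) i => Site.tdist (fun k => ((((q.src k).val * F.L ^ i : ℕ)) : ZMod ((F.P K).sitesPerDir 0))) (fun k => ((((a.src k).val * F.L ^ j : ℕ)) : ZMod ((F.P K).sitesPerDir 0))) + 64 * F.L ^ i ≤ 64 * F.L ^ j), (gibbsK F ℰp γ K).real ({U : GaugeField (F.P K) 0 (Matrix.specialUnitaryGroup (Fin 2) ℂ) | θBal F.L γ b₀ p₀ (K - i) ≤ GaugeGroup.dist1 (GaugeField.plaqHol (Averaging.iter (fun i' => BlockAveraging.blockAvg (P := F.P K) (j := i') ℰp) i U) q)} ∩ {U : GaugeField (F.P K) 0 (Matrix.specialUnitaryGroup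 (Fin 2) ℂ) | (∀ (i' : ℕ) (q' : Plaq (F.P K) i'), i' < i → Site.tdist (fun k => ((((q'.src k).val * F.L ^ i' : ℕ)) : ZMod ((F.P K).sitesPerDir 0))) (fun k => ((((q.src k).val * F.L ^ i : ℕ)) : ZMod ((F.P K).sitesPerDir 0))) + 64 * F.L ^ i' ≤ 64 * F.L ^ i → GaugeGroup.dist1 (GaugeField.plaqHol (Averaging.iter (fun i' => BlockAveraging.blockAvg (P := F.P K) (j := i') ℰp) i' U) q') < θBal F.L γ b₀ p₀ (K - i'))}) :=
          Finset.sum_le_sum fun i _ => measureReal_biUnion_finset_le _ _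
      _ = ∑ q ∈ (Finset.univ.filter fun q : Plaq (F.P K) 0 => Site.tdist (fun k => ((((q.src k).val * F.L ^ 0 : ℕ)) : ZMod ((F.P K).sitesPerDir 0))) (fun k => ((((a.src k).val * F.L ^ j : ℕ)) : ZMod ((F.P K).sitesPerDir 0))) + 64 * F.L ^ 0 ≤ 64 * F.L ^ j), (gibbsK F ℰp γ K).real ({U : GaugeField (F.P K) 0 (Matrix.specialUnitaryGroup (Fin 2) ℂ) | θBal F.L γ b₀ p₀ (K - 0) ≤ GaugeGroup.dist1 (GaugeField.plaqHol (Averaging.iter (fun i' => BlockAveraging.blockAvg (P := F.P K) (j := i') ℰp) 0 U) q)} ∩ {U : GaugeField (F.P K) 0 (Matrix.specialUnitaryGroup (Fin 2) ℂ) | (∀ (i' : ℕ) (q' : Plaq (F.P K) i'), i' < 0 → Site.tdist (fun k => ((((q'.src k).val * F.L ^ i' : ℕ)) : ZMod ((F.P K).sitesPerDir 0))) (fun k => ((((q.src k).val * F.L ^ 0 : ℕ)) : ZMod ((F.P K).sitesPerDir 0))) + 64 * F.L ^ i' ≤ 64 * F.L ^ 0 → GaugeGroup.dist1 (GaugeField.plaqHol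 (Averaging.iter (fun i' => BlockAveraging.blockAvg (P := F.P K) (j := i') ℰp) i' U) q') < θBal F.L γ b₀ p₀ (K - i'))}) +
            ∑ i ∈ Finset.Ico 1 j, ∑ q ∈ (Finset.univ.filter fun q : Plaq (F.P K) i => Site.tdist (fun k => ((((q.src k).val * F.L ^ i : ℕ)) : ZMod ((F.P K).sitesPerDir 0))) (fun k => ((((a.src k).val * F.L ^ j : ℕ)) : ZMod ((F.P K).sitesPerDir 0))) + 64 * F.L ^ i ≤ 64 * F.L ^ j), (gibbsK F ℰp γ K).real ({U : GaugeField (F.P K) 0 (Matrix.specialUnitaryGroup (Fin 2) ℂ) | θBal F.L γ b₀ p₀ (K - i) ≤ GaugeGroup.dist1 (GaugeField.plaqHol (Averaging.iter (fun i' => BlockAveraging.blockAvg (P := F.P K) (j := i') ℰp) i U) q)} ∩ {U : GaugeField (F.P K) 0 (Matrix.specialUnitaryGroup (Fin 2) ℂ) | (∀ (i' : ℕ) (q' : Plaq (F.P K) i'), i' < i → Site.tdist (fun k => ((((q'.src k).val * F.L ^ i' : ℕ)) : ZMod ((F.P K).sitesPerDir 0))) (fun k => ((((q.src k).val * F.L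 ^ i : ℕ)) : ZMod ((F.P K).sitesPerDir 0))) + 64 * F.L ^ i' ≤ 64 * F.L ^ i → GaugeGroup.dist1 (GaugeField.plaqHol (Averaging.iter (fun i' => BlockAveraging.blockAvg (P := F.P K) (j := i') ℰp) i' U) q') < θBal F.L γ b₀ p₀ (K - i'))}) := by
          rw [Finset.range_eq_Ico, Finset.sum_eq_sum_Ico_succ_bot hj]
      _ ≤ 9 * 129 ^ 3 * ((F.L : ℝ) ^ j) ^ 3 * (C₀ * ((γ * ((F.L : ℝ)⁻¹) ^ K)⁻¹) ^ 5 * Real.exp (-(c₀ * B10.pFun b₀ p₀ (Real.sqrt (γ * ((F.L : ℝ)⁻¹) ^ (K))) ^ 2))) +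
            ∑ i ∈ Finset.Ico 1 j, 9 * 129 ^ 3 * ((F.L : ℝ) ^ (j - i)) ^ 3 * (Cc * Real.exp (-(c₁ * B10.pFun b₀ p₀ (Real.sqrt (γ * ((F.L : ℝ)⁻¹) ^ (K - i)))))) := by
          refine add_le_add ?_ (Finset.sum_le_sum fun i hi' => ?_)
          · calc ∑ q ∈ (Finset.univ.filter fun q : Plaq (F.P K) 0 => Site.tdist (fun k => ((((q.src k).val * F.L ^ 0 : ℕ)) : ZMod ((F.P K).sitesPerDir 0))) (fun k => ((((a.src k).val * F.L ^ j : ℕ)) : ZMod ((F.P K).sitesPerDir 0))) + 64 * F.L ^ 0 ≤ 64 * F.L ^ j), (gibbsK F ℰp γ K).real ({U : GaugeField (F.P K) 0 (Matrix.specialUnitaryGroup (Fin 2) ℂ) | θBal F.L γ b₀ p₀ (K - 0) ≤ GaugeGroup.dist1 (GaugeField.plaqHol (Averaging.iter (fun i' => BlockAveraging.blockAvg (P := F.P K) (j := i') ℰp) 0 U) q)} ∩ {U : GaugeField (F.P K) 0 (Matrix.specialUnitaryGroup (Fin 2) ℂ) | (∀ (i' : ℕ) (q' : Plaq (F.P K)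 i'), i' < 0 → Site.tdist (fun k => ((((q'.src k).val * F.L ^ i' : ℕ)) : ZMod ((F.P K).sitesPerDir 0))) (fun k => ((((q.src k).val * F.L ^ 0 : ℕ)) : ZMod ((F.P K).sitesPerDir 0))) + 64 * F.L ^ i' ≤ 64 * F.L ^ 0 → GaugeGroup.dist1 (GaugeField.plaqHol (Averaging.iter (fun i' => BlockAveraging.blockAvg (P := F.P K) (j := i') ℰp) i' U) q') < θBal F.L γ b₀ p₀ (K - i'))})
                ≤ ∑ q ∈ (Finset.univ.filter fun q : Plaq (F.P K) 0 => Site.tdist (fun k => ((((q.src k).val * F.L ^ 0 : ℕ)) : ZMod ((F.P K).sitesPerDir 0))) (fun k => ((((a.src k).val * F.L ^ j : ℕ)) : ZMod ((F.P K).sitesPerDir 0))) + 64 * F.L ^ 0 ≤ 64 * F.L ^ j), C₀ * ((γ * ((F.L : ℝ)⁻¹) ^ K)⁻¹) ^ 5 * Real.exp (-(c₀ * B10.pFun b₀ p₀ (Real.sqrt (γ * ((F.L : ℝ)⁻¹) ^ (K))) ^ 2)) :=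
                  Finset.sum_le_sum fun q _ => h0 q
              _ = ((Finset.univ.filter fun q : Plaq (F.P K) 0 => Site.tdist (fun k => ((((q.src k).val * F.L ^ 0 : ℕ)) : ZMod ((F.P K).sitesPerDir 0))) (fun k => ((((a.src k).val * F.L ^ j : ℕ)) : ZMod ((F.P K).sitesPerDir 0))) + 64 * F.L ^ 0 ≤ 64 * F.L ^ j)).card * (C₀ * ((γ * ((F.L : ℝ)⁻¹) ^ K)⁻¹) ^ 5 * Real.exp (-(c₀ * B10.pFun b₀ p₀ (Real.sqrt (γ * ((F.L : ℝ)⁻¹) ^ (K))) ^ 2))) := by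
                  rw [Finset.sum_const, nsmul_eq_mul]
              _ ≤ 9 * 129 ^ 3 * ((F.L : ℝ) ^ j) ^ 3 * (C₀ * ((γ * ((F.L : ℝ)⁻¹) ^ K)⁻¹) ^ 5 * Real.exp (-(c₀ * B10.pFun b₀ p₀ (Real.sqrt (γ * ((F.L : ℝ)⁻¹) ^ (K))) ^ 2))) := by
                  have h := hN 0 (Nat.zero_le j)
                  rw [Nat.sub_zero] at h
                  exact mul_le_mul_of_nonneg_right h (by positivity)
          · calc ∑ q ∈ (Finset.univ.filter fun q : Plaq (F.P K) i => Site.tdist (fun k => ((((q.src k).val * F.L ^ i : ℕ)) : ZMod ((F.P K).sitesPerDir 0))) (fun k => ((((a.src k).val * F.L ^ j : ℕ)) : ZMod ((F.P K).sitesPerDir 0))) + 64 * F.L ^ i ≤ 64 * F.L ^ j), (gibbsK F ℰp γ K).real ({U : GaugeField (F.P K) 0 (Matrix.specialUnitaryGroup (Fin 2) ℂ) | θBal F.L γ b₀ p₀ (K - i) ≤ GaugeGroup.dist1 (GaugeField.plaqHol (Averaging.iter (fun i' => BlockAveraging.blockAvg (P := F.P K) (j := i') ℰp) i U) q)} ∩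 {U : GaugeField (F.P K) 0 (Matrix.specialUnitaryGroup (Fin 2) ℂ) | (∀ (i' : ℕ) (q' : Plaq (F.P K) i'), i' < i → Site.tdist (fun k => ((((q'.src k).val * F.L ^ i' : ℕ)) : ZMod ((F.P K).sitesPerDir 0))) (fun k => ((((q.src k).val * F.L ^ i : ℕ)) : ZMod ((F.P K).sitesPerDir 0))) + 64 * F.L ^ i' ≤ 64 * F.L ^ i → GaugeGroup.dist1 (GaugeField.plaqHol (Averaging.iter (fun i' => BlockAveraging.blockAvg (P := F.P K) (j := i') ℰp) i' U) q') < θBal F.L γ b₀ p₀ (K - i'))})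
                ≤ ∑ q ∈ (Finset.univ.filter fun q : Plaq (F.P K) i => Site.tdist (fun k => ((((q.src k).val * F.L ^ i : ℕ)) : ZMod ((F.P K).sitesPerDir 0))) (fun k => ((((a.src k).val * F.L ^ j : ℕ)) : ZMod ((F.P K).sitesPerDir 0))) + 64 * F.L ^ i ≤ 64 * F.L ^ j), Cc * Real.exp (-(c₁ * B10.pFun b₀ p₀ (Real.sqrt (γ * ((F.L : ℝ)⁻¹) ^ (K - i))))) :=
                  Finset.sum_le_sum fun q _ => hi i hi' q
              _ = ((Finset.univ.filter fun q : Plaq (F.P K) i => Site.tdist (fun k => ((((q.src k).val * F.L ^ i : ℕ)) : ZMod ((F.P K).sitesPerDir 0))) (fun k => ((((a.src k).val * F.L ^ j : ℕ)) : ZMod ((F.P K).sitesPerDir 0))) + 64 * F.L ^ i ≤ 64 * F.L ^ j)).card * (Cc * Real.exp (-(c₁ * B10.pFun b₀ p₀ (Real.sqrt (γ * ((F.L : ℝ)⁻¹) ^ (K - i)))))) := by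
                  rw [Finset.sum_const, nsmul_eq_mul]
              _ ≤ 9 * 129 ^ 3 * ((F.L : ℝ) ^ (j - i)) ^ 3 * (Cc * Real.exp (-(c₁ * B10.pFun b₀ p₀ (Real.sqrt (γ * ((F.L : ℝ)⁻¹) ^ (K - i)))))) :=
                  mul_le_mul_of_nonneg_right (hN i (Finset.mem_Ico.mp hi').2.le) (by positivity)
      _ ≤ 1 / 4 := HA γ hγ hγA' K j (by omega)
  exact local_step_lin F hγ hγ2 hb₀ hjK a hCL (HC F γ rfl hγ hγC' K) (HLip' F γ rfl hγ hγLip' K j hj hjK a)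
    (HM F γ rfl hγ hγM' K j hj (by omega) a) hGc

/-! ## §3 The knit: `HistoryTailL` from a Poincaré-class K1 -/

/-- ★★★ **`UnitScaleTilt.HistoryTailL ⟸ K1-exp ∧ BlockLipschitzL ∧ MeanDeviationL`** (BY NAME): line #12 closes the crux
stmt-QuantumFields-19936 from the EXPONENTIAL (Poincaré ∕ spectral-gap class) concentration of box-local gauge-invariant Lipschitz observables at
the Hodge–Poincaré scale — `Gibbs_K{r ≤ f − ∫f} ≤ Cc·exp(−cc·√β_K·r∕(n·Λ))`, constants depending on `L` only — together with the route's
deterministic K2 (`BlockLipschitzL`) and the shared first-moment crux (`MeanDeviationL`).  Composition: ✓`local_tail_lin` (the global finer-small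
event lies in the local good set) ∘ ✓`historyTailL_of_linearTail` (B′).  The registered Gaussian crux is a special case
(✓`expTail_of_gaussTail`).  Route glue only: K1-exp, K2 and `MeanDeviationL` are NOT proved. [cite: Balaban1985UV3, (7) p.257 and (71) p.273] -/
theorem historyTailL_of_expConcentration
    (hC : ∀ (L : ℕ), ∃ (Cc cc : ℝ), 0 ≤ Cc ∧ 0 < cc ∧ ∃ γ₁ : ℝ, 0 < γ₁ ∧ γ₁ ≤ 1 ∧
      ∀ (F : T3Family) (γ : ℝ), F.L = L → 0 < γ → γ ≤ γ₁ → ∀ (K n : ℕ), 1 ≤ n →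
        (n : ℝ) ≤ (F.scheme ℰp γ).β K → 2 * n ≤ (F.P K).sitesPerDir 0 →
        ∀ (x₀ : Site (F.P K) 0) (f : GaugeField (F.P K) 0 (Matrix.specialUnitaryGroup (Fin 2) ℂ) → ℝ) (Λ : ℝ), 0 < Λ →
          Measurable f → GaugeField.GaugeInvariant f →
          (∀ U U' : GaugeField (F.P K) 0 (Matrix.specialUnitaryGroup (Fin 2) ℂ),
            (∀ b : PBond (F.P K) 0, (∀ k, (b.src k - x₀ k).val < n) → (∀ k, (b.tgt k - x₀ k).val < n) → U b = U' b) →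
              f U = f U') →
          (∀ U U' : GaugeField (F.P K) 0 (Matrix.specialUnitaryGroup (Fin 2) ℂ),
            |f U - f U'| ≤ Λ * Real.sqrt (∑ b : PBond (F.P K) 0, GaugeGroup.dist1 (U b * (U' b)⁻¹) ^ 2)) →
          ∀ r : ℝ, 0 ≤ r →
            (gibbsK F ℰp γ K).real {U | r ≤ f U - ∫ V, f V ∂(gibbsK F ℰp γ K)} ≤
              Cc * Real.exp (-(cc * Real.sqrt ((F.scheme ℰp γ).β K) * r / ((n : ℝ) * Λ))))
    (hLip : Summit.QuantumFields.YangMills.Theses.PoincareLipschitz.BlockLipschitzL)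
    (hM : Summit.QuantumFields.YangMills.Theses.PoincareLipschitz.MeanDeviationL) :
    Summit.QuantumFields.YangMills.Theses.UnitScaleTilt.HistoryTailL := by
  refine historyTailL_of_linearTail fun L => ?_
  obtain ⟨bmin, C, c, hC0, hc, H⟩ := local_tail_lin hC hLip hM L
  refine ⟨bmin, C, c, hC0, hc, fun b₀ p₀ hbmin hb₀ hp₀ => ?_⟩
  obtain ⟨γ₁, hγ₁, hγ₁1, HF⟩ := H b₀ p₀ hbmin hb₀ hp₀
  refine ⟨γ₁, hγ₁, hγ₁1, fun F γ hFL hγ hle K j hj hjK a => ?_⟩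
  haveI := isProbabilityMeasure_gibbsK F ℰp hγ.le K
  -- the global finer-small event lies in the local good set
  have hsub : ({U : GaugeField (F.P K) 0 (Matrix.specialUnitaryGroup (Fin 2) ℂ) | θBal F.L γ b₀ p₀ (K - j) ≤ GaugeGroup.dist1 (GaugeField.plaqHol (Averaging.iter (fun i' => BlockAveraging.blockAvg (P := F.P K) (j := i') ℰp) j U) a)} ∩
        {U : GaugeField (F.P K) 0 (Matrix.specialUnitaryGroup (Fin 2) ℂ) | ∀ i, i < j → PlaqSmall (θBal F.L γ b₀ p₀ (K - i)) (Averaging.iter (fun i' => BlockAveraging.blockAvg (P := F.P K) (j := i') ℰp) i U)}) ⊆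
      ({U : GaugeField (F.P K) 0 (Matrix.specialUnitaryGroup (Fin 2) ℂ) | θBal F.L γ b₀ p₀ (K - j) ≤ GaugeGroup.dist1 (GaugeField.plaqHol (Averaging.iter (fun i' => BlockAveraging.blockAvg (P := F.P K) (j := i') ℰp) j U) a)} ∩ {U : GaugeField (F.P K) 0 (Matrix.specialUnitaryGroup (Fin 2) ℂ) | (∀ (i : ℕ) (q : Plaq (F.P K) i), i < j → Site.tdist (fun k => ((((q.src k).val * F.L ^ i : ℕ)) : ZMod ((F.P K).sitesPerDir 0))) (fun k => ((((a.src k).val * F.L ^ j : ℕ)) : ZMod ((F.P K).sitesPerDir 0))) + 64 * F.L ^ i ≤ 64 * F.L ^ j → GaugeGroup.dist1 (GaugeField.plaqHol (Averaging.iter (fun i' => BlockAveraging.blockAvg (P := F.P K) (j := i') ℰp) i U) q) < θBal F.L γ b₀ p₀ (K - i))}) := by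
    rintro U ⟨hU1, hU2⟩
    exact ⟨hU1, fun i q hi _ => hU2 i hi q⟩
  exact (measureReal_mono hsub (measure_ne_top _ _)).trans (HF F γ hFL hγ hle K j hj hjK a)

end Summit.QuantumFields.YangMills.Theorems.PoincareLipschitzLinear

end
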